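import Mathlib

/-!
# The two-step staircase Kleitman inequality (= relaxed two-family Marica–Schönheim, "RFB")

Support file for crux `stmt-CriticalPhenomena-4575` (master-family programme, quadratic four-point row `Q44b`
of `prim-bnk-1` gen 13; combinatorial core of the oriented-antipodal route, `prim-l12-p6` gen 9 §8–9), seat
`prim-bnk-1` gen 16; memo `run/shared/lean/prim/prim-l12/FROM-prim-bnk-1-gen16-STAIRCASE-KLEITMAN.md` §8.

**Theorem (`StaircaseKleitman.card_elements_le_card_targets`).**  Let `α` be a finite type and let
`P ⊇ Q`, `U`, `V` be up-sets of `Finset α` (families closed under supersets).  Put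
`E₁ = {S ∈ P : Sᶜ ∈ U, Sᶜ ∉ V}`, `E₂ = {S ∈ Q : Sᶜ ∈ V}` and `Z = (P ∩ U) ∪ (Q ∩ V)`.  Then
`#E₁ + #E₂ ≤ #Z`.

For `Q = P` this is Kleitman's inequality in the composite form `#{S ∈ P : Sᶜ ∈ W} ≤ #(P ∩ W)`; the two-step
("staircase") version is equivalent (memo §1) to the relaxed two-family Marica–Schönheim inequality RFB of
`prim-l12-p6` gen 9 (for families `𝒜, ℬ` with no `B ⊆ A`,
`#𝒜 + #ℬ ≤ #↓[(𝒜 \ 𝒜) ∪ (ℬ \ 𝒜) ∪ (ℬ \ ℬ)]`), to its GRFB / FB-MS′ forms, and to the statement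
`A(W) ≥ I(W)` for the two-step staircase `W = (D × U₁) ∪ (D₂ × U₂)` of a down-set pair `D ⊇ D₂`.

**Proof (GF(2)-rank of the inclusion matrix).**  The key statement is
`StaircaseKleitman.exists_odd_target`: for every nonempty `𝒮 ⊆ E₁ ∪ E₂` there is a target `T ∈ Z`
containing an ODD number of members of `𝒮`.  (a) For a `⊆`-maximal `M ∈ 𝒮` the parity identity
`∑_{R ⊆ M} #{S ∈ 𝒮 : S ∩ M ⊆ R} = ∑_{S ∈ 𝒮} 2 ^ #(M \ S) ≡ 1 (mod 2)` (`exists_odd_trace`) gives `R ⊆ M` with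
`T* = Mᶜ ∪ R` containing an odd number of members; `T*` contains some member, so `T* ∈ P`; if `Mᶜ ∈ U` then
`T* ∈ P ∩ U ⊆ Z`, so every maximal member lies in `E₂` (`M ∈ Q`, `Mᶜ ∈ V`).  (b) A minimal member `m`
below a maximal `M` has `mᶜ ⊇ Mᶜ ∈ V`, so `m ∉ E₁`, so `m ∈ Q`; hence `𝒮 ⊆ Q`.  (c) Then `T* ⊇ Mᶜ ∈ V` and
`T*` contains a member of `𝒮 ⊆ Q`, so `T* ∈ Q ∩ V ⊆ Z` — contradiction.  The counting theorem follows because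
`𝒮 ↦ {T ∈ Z : #{S ∈ 𝒮 : S ⊆ T} odd}` is then injective on the subfamilies of `E₁ ∪ E₂`
(`parityMap_injOn`), whence `2 ^ #(E₁ ∪ E₂) ≤ 2 ^ #Z`.

Pure finite combinatorics; no named facts, no sorries, standard axioms.
-/

namespace Summit.CriticalPhenomena.PercolationContinuityZ3.Theorems

namespace StaircaseKleitman

open Finset
open scoped FinsetFamily

variable {α : Type*} [DecidableEq α]

/-- For `A ⊆ M`, the number of sets `R` with `A ⊆ R ⊆ M` is `2 ^ (#M - #A)`. -/
theorem card_filter_powerset_superset (A M : Finset α) (h : A ⊆ M) :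
    #(M.powerset.filter (fun R => A ⊆ R)) = 2 ^ (#M - #A) := by
  rw [← Finset.Icc_eq_filter_powerset]
  exact Finset.card_Icc_finset h

/-- **Odd-trace lemma.**  If `M ∈ 𝒮` and no member of `𝒮` strictly contains `M`, then for some `R ⊆ M` the
number of members `S ∈ 𝒮` with `S ∩ M ⊆ R` is odd.  (Double count `∑_{R ⊆ M} #{S : S ∩ M ⊆ R} =
∑_{S ∈ 𝒮} 2 ^ (#M - #(S ∩ M))`; only the term `S = M` is odd.) -/
theorem exists_odd_trace (𝒮 : Finset (Finset α)) (M : Finset α) (hM : M ∈ 𝒮)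
    (hmax : ∀ S ∈ 𝒮, M ⊆ S → S = M) :
    ∃ R ∈ M.powerset, Odd #(𝒮.filter (fun S => S ∩ M ⊆ R)) := by
  by_contra hcon
  simp only [not_exists, not_and] at hcon
  -- every fibre count is even
  have heven : ∀ R ∈ M.powerset, Even #(𝒮.filter (fun S => S ∩ M ⊆ R)) := by
    intro R hR
    exact Nat.not_odd_iff_even.1 (hcon R hR)
  -- double counting
  have hdc : ∑ R ∈ M.powerset, #(𝒮.filter (fun S => S ∩ M ⊆ R))
      = ∑ S ∈ 𝒮, #(M.powerset.filter (fun R => S ∩ M ⊆ R)) := by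
    simp_rw [Finset.card_filter]
    exact Finset.sum_comm
  have hpow : ∑ S ∈ 𝒮, #(M.powerset.filter (fun R => S ∩ M ⊆ R))
      = ∑ S ∈ 𝒮, 2 ^ (#M - #(S ∩ M)) := by
    refine Finset.sum_congr rfl ?_
    intro S _
    exact card_filter_powerset_superset (S ∩ M) M Finset.inter_subset_right
  -- the right-hand side is odd: the term `S = M` equals `1`, all others are even
  have hodd : Odd (∑ S ∈ 𝒮, 2 ^ (#M - #(S ∩ M))) := by
    rw [← Finset.add_sum_erase 𝒮 _ hM]
    have h1 : 2 ^ (#M - #(M ∩ M)) = 1 := by simp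
    rw [h1]
    refine Odd.add_even odd_one ?_
    refine Finset.even_sum _ ?_
    intro S hS
    have hSne : S ≠ M := Finset.ne_of_mem_erase hS
    have hS𝒮 : S ∈ 𝒮 := Finset.mem_of_mem_erase hS
    have hlt : #(S ∩ M) < #M := by
      refine Finset.card_lt_card ?_
      refine lt_of_le_of_ne Finset.inter_subset_right ?_
      intro hEq
      have hMS : M ⊆ S := by
        have : S ∩ M = M := hEq
        rw [← this]
        exact Finset.inter_subset_left
      exact hSne (hmax S hS𝒮 hMS)
    have hne : #M - #(S ∩ M) ≠ 0 := by omega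
    exact (Nat.even_pow' hne).2 (by decide)
  have hevenSum : Even (∑ R ∈ M.powerset, #(𝒮.filter (fun S => S ∩ M ⊆ R))) :=
    Finset.even_sum _ heven
  rw [hdc, hpow] at hevenSum
  exact (Nat.not_even_iff_odd.2 hodd) hevenSum

variable [Fintype α]

/-- `S ⊆ Mᶜ ∪ R` iff the part of `S` inside `M` lies in `R`. -/
theorem subset_compl_union_iff (S M R : Finset α) : S ⊆ Mᶜ ∪ R ↔ S ∩ M ⊆ R := by
  constructor
  · intro h x hx
    rcases Finset.mem_inter.1 hx with ⟨hxS, hxM⟩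
    rcases Finset.mem_union.1 (h hxS) with hxc | hxR
    · exact absurd hxM (Finset.mem_compl.1 hxc)
    · exact hxR
  · intro h x hxS
    by_cases hxM : x ∈ M
    · exact Finset.mem_union_right _ (h (Finset.mem_inter.2 ⟨hxS, hxM⟩))
    · exact Finset.mem_union_left _ (Finset.mem_compl.2 hxM)

/-- **Odd-target theorem (GF(2) rank of the inclusion matrix).**  `P ⊇ Q`, `U`, `V` up-sets of `Finset α`;
`Z = (P ∩ U) ∪ (Q ∩ V)`.  If every member `S` of a nonempty family `𝒮` satisfies
`(S ∈ P ∧ Sᶜ ∈ U ∧ Sᶜ ∉ V) ∨ (S ∈ Q ∧ Sᶜ ∈ V)`, then some target `T ∈ Z` contains an odd number of members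
of `𝒮`.  [this work, memo §8] -/
theorem exists_odd_target (P Q U V : Finset (Finset α))
    (hP : IsUpperSet (P : Set (Finset α))) (hQ : IsUpperSet (Q : Set (Finset α)))
    (hU : IsUpperSet (U : Set (Finset α))) (hV : IsUpperSet (V : Set (Finset α))) (hQP : Q ⊆ P)
    (𝒮 : Finset (Finset α)) (hne : 𝒮.Nonempty)
    (hE : ∀ S ∈ 𝒮, (S ∈ P ∧ Sᶜ ∈ U ∧ Sᶜ ∉ V) ∨ (S ∈ Q ∧ Sᶜ ∈ V)) :
    ∃ T ∈ (P ∩ U) ∪ (Q ∩ V), Odd #(𝒮.filter (fun S => S ⊆ T)) := by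
  by_contra hcon
  simp only [not_exists, not_and] at hcon
  -- convenience: up-set closure in `Finset` language
  have upP : ∀ {S T : Finset α}, S ∈ P → S ⊆ T → T ∈ P := fun {S T} hS hST => hP hST hS
  have upQ : ∀ {S T : Finset α}, S ∈ Q → S ⊆ T → T ∈ Q := fun {S T} hS hST => hQ hST hS
  have upU : ∀ {S T : Finset α}, S ∈ U → S ⊆ T → T ∈ U := fun {S T} hS hST => hU hST hS
  have upV : ∀ {S T : Finset α}, S ∈ V → S ⊆ T → T ∈ V := fun {S T} hS hST => hV hST hS
  have memP : ∀ S ∈ 𝒮, S ∈ P := by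
    intro S hS
    rcases hE S hS with h | h
    · exact h.1
    · exact hQP h.1
  -- Step (a): a maximal member `M` has an odd target `T* = Mᶜ ∪ R ⊇ Mᶜ` that contains a member of `𝒮`;
  -- consequently `M ∈ Q` and `Mᶜ ∈ V`.
  have stepA : ∀ M ∈ 𝒮, (∀ S ∈ 𝒮, M ⊆ S → S = M) →
      (M ∈ Q ∧ Mᶜ ∈ V) ∧
        ∃ T : Finset α, Mᶜ ⊆ T ∧ (∃ S₀ ∈ 𝒮, S₀ ⊆ T) ∧ Odd #(𝒮.filter (fun S => S ⊆ T)) := by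
    intro M hM hmax
    obtain ⟨R, _, hodd⟩ := exists_odd_trace 𝒮 M hM hmax
    set T : Finset α := Mᶜ ∪ R with hT
    have hfilt : 𝒮.filter (fun S => S ⊆ T) = 𝒮.filter (fun S => S ∩ M ⊆ R) := by
      refine Finset.filter_congr ?_
      intro S _
      exact subset_compl_union_iff S M R
    have hoddT : Odd #(𝒮.filter (fun S => S ⊆ T)) := by rw [hfilt]; exact hodd
    have hMc : Mᶜ ⊆ T := Finset.subset_union_left
    -- some member lies below `T`
    have hS₀ : ∃ S₀ ∈ 𝒮, S₀ ⊆ T := by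
      have hpos : 0 < #(𝒮.filter (fun S => S ⊆ T)) := Nat.pos_of_ne_zero (fun h0 => by
        rw [h0] at hoddT; exact (Nat.not_odd_iff_even.2 (by decide)) hoddT)
      obtain ⟨S₀, hS₀⟩ := Finset.card_pos.1 hpos
      exact ⟨S₀, (Finset.mem_filter.1 hS₀).1, (Finset.mem_filter.1 hS₀).2⟩
    obtain ⟨S₀, hS₀𝒮, hS₀T⟩ := hS₀
    have hTP : T ∈ P := upP (memP S₀ hS₀𝒮) hS₀T
    -- `T ∉ Z`
    have hTZ : T ∉ (P ∩ U) ∪ (Q ∩ V) := fun hz => hcon T hz hoddT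
    -- hence `M ∉ E₁`
    have hM2 : M ∈ Q ∧ Mᶜ ∈ V := by
      rcases hE M hM with h1 | h2
      · exfalso
        have hTU : T ∈ U := upU h1.2.1 hMc
        exact hTZ (Finset.mem_union_left _ (Finset.mem_inter.2 ⟨hTP, hTU⟩))
      · exact h2
    exact ⟨hM2, T, hMc, ⟨S₀, hS₀𝒮, hS₀T⟩, hoddT⟩
  -- Step (b): every member of `𝒮` lies in `Q`.
  have stepB : ∀ S ∈ 𝒮, S ∈ Q := by
    intro S hS
    -- a minimal member `m ⊆ S`
    have hbelow : (𝒮.filter (fun S' => S' ⊆ S)).Nonempty := ⟨S, Finset.mem_filter.2 ⟨hS, subset_rfl⟩⟩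
    obtain ⟨m, hm, hmmin⟩ := Finset.exists_min_image (𝒮.filter (fun S' => S' ⊆ S)) card hbelow
    have hm𝒮 : m ∈ 𝒮 := (Finset.mem_filter.1 hm).1
    have hmS : m ⊆ S := (Finset.mem_filter.1 hm).2
    -- a maximal member `M ⊇ m`
    have habove : (𝒮.filter (fun S' => m ⊆ S')).Nonempty := ⟨m, Finset.mem_filter.2 ⟨hm𝒮, subset_rfl⟩⟩
    obtain ⟨M, hM, hMmax⟩ := Finset.exists_max_image (𝒮.filter (fun S' => m ⊆ S')) card habove
    have hM𝒮 : M ∈ 𝒮 := (Finset.mem_filter.1 hM).1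
    have hmM : m ⊆ M := (Finset.mem_filter.1 hM).2
    have hmaxM : ∀ S' ∈ 𝒮, M ⊆ S' → S' = M := by
      intro S' hS' hMS'
      have hS'f : S' ∈ 𝒮.filter (fun S'' => m ⊆ S'') := Finset.mem_filter.2 ⟨hS', hmM.trans hMS'⟩
      exact (Finset.eq_of_subset_of_card_le hMS' (hMmax S' hS'f)).symm
    obtain ⟨⟨_, hMcV⟩, _⟩ := stepA M hM𝒮 hmaxM
    -- `mᶜ ⊇ Mᶜ ∈ V`
    have hmcV : mᶜ ∈ V := upV hMcV (Finset.compl_subset_compl.2 hmM)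
    have hmQ : m ∈ Q := by
      rcases hE m hm𝒮 with h1 | h2
      · exact absurd hmcV h1.2.2
      · exact h2.1
    exact upQ hmQ hmS
  -- Step (c): contradiction at a maximal member.
  obtain ⟨M, hM, hMmax⟩ := Finset.exists_max_image 𝒮 card hne
  have hmaxM : ∀ S' ∈ 𝒮, M ⊆ S' → S' = M :=
    fun S' hS' hMS' => (Finset.eq_of_subset_of_card_le hMS' (hMmax S' hS')).symm
  obtain ⟨⟨_, hMcV⟩, T, hMcT, ⟨S₀, hS₀𝒮, hS₀T⟩, hoddT⟩ := stepA M hM hmaxM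
  have hTV : T ∈ V := upV hMcV hMcT
  have hTQ : T ∈ Q := upQ (stepB S₀ hS₀𝒮) hS₀T
  exact hcon T (Finset.mem_union_right _ (Finset.mem_inter.2 ⟨hTQ, hTV⟩)) hoddT

/-- The parity signature of a subfamily `𝒮` on the target family `Z`: the targets containing an odd number of
members of `𝒮`. -/
theorem parityMap_injOn (P Q U V : Finset (Finset α))
    (hP : IsUpperSet (P : Set (Finset α))) (hQ : IsUpperSet (Q : Set (Finset α)))
    (hU : IsUpperSet (U : Set (Finset α))) (hV : IsUpperSet (V : Set (Finset α))) (hQP : Q ⊆ P)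
    (E : Finset (Finset α))
    (hE : ∀ S ∈ E, (S ∈ P ∧ Sᶜ ∈ U ∧ Sᶜ ∉ V) ∨ (S ∈ Q ∧ Sᶜ ∈ V)) :
    Set.InjOn (fun 𝒮 : Finset (Finset α) =>
        ((P ∩ U) ∪ (Q ∩ V)).filter (fun T => Odd #(𝒮.filter (fun S => S ⊆ T))))
      (E.powerset : Set (Finset (Finset α))) := by
  intro 𝒮₁ h₁ 𝒮₂ h₂ heq
  have h₁' : 𝒮₁ ⊆ E := Finset.mem_powerset.1 (Finset.mem_coe.1 h₁)
  have h₂' : 𝒮₂ ⊆ E := Finset.mem_powerset.1 (Finset.mem_coe.1 h₂)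
  by_contra hne
  -- the symmetric difference is a nonempty subfamily of `E` with an even count in every target
  set 𝒟 : Finset (Finset α) := (𝒮₁ \ 𝒮₂) ∪ (𝒮₂ \ 𝒮₁) with h𝒟
  have h𝒟E : ∀ S ∈ 𝒟, (S ∈ P ∧ Sᶜ ∈ U ∧ Sᶜ ∉ V) ∨ (S ∈ Q ∧ Sᶜ ∈ V) := by
    intro S hS
    rcases Finset.mem_union.1 hS with h | h
    · exact hE S (h₁' (Finset.mem_sdiff.1 h).1)
    · exact hE S (h₂' (Finset.mem_sdiff.1 h).1)
  have h𝒟ne : 𝒟.Nonempty := by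
    rw [Finset.nonempty_iff_ne_empty]
    intro hemp
    apply hne
    have h12 : 𝒮₁ \ 𝒮₂ = ∅ :=
      Finset.subset_empty.1 (by rw [← hemp]; exact Finset.subset_union_left)
    have h21 : 𝒮₂ \ 𝒮₁ = ∅ :=
      Finset.subset_empty.1 (by rw [← hemp]; exact Finset.subset_union_right)
    exact Finset.Subset.antisymm (Finset.sdiff_eq_empty_iff_subset.1 h12)
      (Finset.sdiff_eq_empty_iff_subset.1 h21)
  obtain ⟨T, hTZ, hodd⟩ := exists_odd_target P Q U V hP hQ hU hV hQP 𝒟 h𝒟ne h𝒟E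
  -- parity bookkeeping at `T`
  have hsame : Odd #(𝒮₁.filter (fun S => S ⊆ T)) ↔ Odd #(𝒮₂.filter (fun S => S ⊆ T)) := by
    have hT := congrArg (fun F => T ∈ F) heq
    simp only [Finset.mem_filter, eq_iff_iff] at hT
    constructor
    · intro h; exact (hT.1 ⟨hTZ, h⟩).2
    · intro h; exact (hT.2 ⟨hTZ, h⟩).2
  set a := #((𝒮₁ \ 𝒮₂).filter (fun S => S ⊆ T)) with ha
  set b := #((𝒮₂ \ 𝒮₁).filter (fun S => S ⊆ T)) with hb
  set c := #((𝒮₁ ∩ 𝒮₂).filter (fun S => S ⊆ T)) with hc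
  have hdisj : Disjoint (𝒮₁ \ 𝒮₂) (𝒮₂ \ 𝒮₁) := by
    rw [Finset.disjoint_left]
    intro S hS hS'
    exact (Finset.mem_sdiff.1 hS).2 (Finset.mem_sdiff.1 hS').1
  have hcard𝒟 : #(𝒟.filter (fun S => S ⊆ T)) = a + b := by
    rw [h𝒟, Finset.filter_union]
    exact Finset.card_union_of_disjoint (Finset.disjoint_filter_filter hdisj)
  have hsplit₁ : #(𝒮₁.filter (fun S => S ⊆ T)) = a + c := by
    rw [ha, hc, ← Finset.card_union_of_disjoint
      (Finset.disjoint_filter_filter (Finset.disjoint_sdiff_inter 𝒮₁ 𝒮₂)),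
      ← Finset.filter_union, Finset.sdiff_union_inter]
  have hsplit₂ : #(𝒮₂.filter (fun S => S ⊆ T)) = b + c := by
    rw [hb, hc, Finset.inter_comm, ← Finset.card_union_of_disjoint
      (Finset.disjoint_filter_filter (Finset.disjoint_sdiff_inter 𝒮₂ 𝒮₁)),
      ← Finset.filter_union, Finset.sdiff_union_inter]
  have hiff : Even (a + c) ↔ Even (b + c) := by
    rw [← hsplit₁, ← hsplit₂, ← Nat.not_odd_iff_even, ← Nat.not_odd_iff_even]
    exact not_congr hsame
  have h2 : Even ((a + c) + (b + c)) := Nat.even_add.2 hiff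
  have h3 : (a + c) + (b + c) = (a + b) + 2 * c := by ring
  rw [h3, Nat.even_add] at h2
  have heven : Even (a + b) := h2.2 (even_two_mul c)
  rw [← hcard𝒟] at heven
  exact (Nat.not_even_iff_odd.2 hodd) heven

/-- **Two-step staircase Kleitman inequality** (⟺ relaxed two-family Marica–Schönheim "RFB" of
`prim-l12-p6` gen 9).  For up-sets `P ⊇ Q`, `U`, `V` of `Finset α`:
`#{S ∈ P : Sᶜ ∈ U, Sᶜ ∉ V} + #{S ∈ Q : Sᶜ ∈ V} ≤ #((P ∩ U) ∪ (Q ∩ V))`.  [this work, memo §8] -/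
theorem card_elements_le_card_targets (P Q U V : Finset (Finset α))
    (hP : IsUpperSet (P : Set (Finset α))) (hQ : IsUpperSet (Q : Set (Finset α)))
    (hU : IsUpperSet (U : Set (Finset α))) (hV : IsUpperSet (V : Set (Finset α))) (hQP : Q ⊆ P) :
    #(P.filter (fun S => Sᶜ ∈ U ∧ Sᶜ ∉ V)) + #(Q.filter (fun S => Sᶜ ∈ V))
      ≤ #((P ∩ U) ∪ (Q ∩ V)) := by
  set E₁ := P.filter (fun S => Sᶜ ∈ U ∧ Sᶜ ∉ V) with hE₁
  set E₂ := Q.filter (fun S => Sᶜ ∈ V) with hE₂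
  set Z := (P ∩ U) ∪ (Q ∩ V) with hZ
  have hdisj : Disjoint E₁ E₂ := by
    rw [Finset.disjoint_left]
    intro S h1 h2
    exact (Finset.mem_filter.1 h1).2.2 (Finset.mem_filter.1 h2).2
  have hcardE : #(E₁ ∪ E₂) = #E₁ + #E₂ := Finset.card_union_of_disjoint hdisj
  have hE : ∀ S ∈ E₁ ∪ E₂, (S ∈ P ∧ Sᶜ ∈ U ∧ Sᶜ ∉ V) ∨ (S ∈ Q ∧ Sᶜ ∈ V) := by
    intro S hS
    rcases Finset.mem_union.1 hS with h | h
    · exact Or.inl ⟨(Finset.mem_filter.1 h).1, (Finset.mem_filter.1 h).2⟩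
    · exact Or.inr ⟨(Finset.mem_filter.1 h).1, (Finset.mem_filter.1 h).2⟩
  have hinj := parityMap_injOn P Q U V hP hQ hU hV hQP (E₁ ∪ E₂) hE
  -- the parity map sends `(E₁ ∪ E₂).powerset` into `Z.powerset`
  have hmaps : Set.MapsTo (fun 𝒮 : Finset (Finset α) =>
        Z.filter (fun T => Odd #(𝒮.filter (fun S => S ⊆ T))))
      ((E₁ ∪ E₂).powerset : Set (Finset (Finset α))) (Z.powerset : Set (Finset (Finset α))) := by
    intro 𝒮 _
    exact Finset.mem_coe.2 (Finset.mem_powerset.2 (Finset.filter_subset _ _))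
  have hle : #((E₁ ∪ E₂).powerset) ≤ #(Z.powerset) :=
    Finset.card_le_card_of_injOn _ hmaps hinj
  rw [Finset.card_powerset, Finset.card_powerset, hcardE] at hle
  exact (Nat.pow_le_pow_iff_right (by norm_num : 1 < 2)).1 hle

/-- **Relaxed two-family Marica–Schönheim inequality (RFB)**, the conjecture of `prim-l12-p6` gen 9 (memo
`FROM-prim-l12-p6-g9-ORIENTED-ANTIPODAL.md` §8): if no member of `ℬ` is contained in a member of `𝒜`, then
`#𝒜 + #ℬ ≤ #↓[(𝒜 \\ 𝒜) ∪ (ℬ \\ 𝒜) ∪ (ℬ \\ ℬ)]`, where `↓` is the down-closure (`biUnion powerset`) and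
`𝒳 \\ 𝒴 = {X \ Y}` (`Finset.diffs`).  Derived from `card_elements_le_card_targets` with
`P = {S : Sᶜ ⊆ some member of 𝒜 ∪ ℬ}`, `Q = {S : Sᶜ ⊆ some B}`, `U = ↑𝒜`, `V = ↑ℬ` and the bijection `S ↦ Sᶜ`.
[this work, memo §8] -/
theorem card_add_card_le_card_downClosure_diffs (𝒜 ℬ : Finset (Finset α))
    (h : ∀ A ∈ 𝒜, ∀ B ∈ ℬ, ¬ B ⊆ A) :
    #𝒜 + #ℬ ≤ #(((𝒜 \\ 𝒜) ∪ (ℬ \\ 𝒜) ∪ (ℬ \\ ℬ)).biUnion Finset.powerset) := by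
  classical
  -- the four up-sets
  set P : Finset (Finset α) := Finset.univ.filter (fun S => ∃ C ∈ 𝒜 ∪ ℬ, Sᶜ ⊆ C) with hPdef
  set Q : Finset (Finset α) := Finset.univ.filter (fun S => ∃ B ∈ ℬ, Sᶜ ⊆ B) with hQdef
  set U : Finset (Finset α) := Finset.univ.filter (fun S => ∃ A ∈ 𝒜, A ⊆ S) with hUdef
  set V : Finset (Finset α) := Finset.univ.filter (fun S => ∃ B ∈ ℬ, B ⊆ S) with hVdef
  have hP : IsUpperSet (P : Set (Finset α)) := by
    intro S T hST hS
    rcases Finset.mem_filter.1 (Finset.mem_coe.1 hS) with ⟨_, C, hC, hSC⟩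
    exact Finset.mem_coe.2 (Finset.mem_filter.2 ⟨Finset.mem_univ _, C, hC,
      (Finset.compl_subset_compl.2 hST).trans hSC⟩)
  have hQ : IsUpperSet (Q : Set (Finset α)) := by
    intro S T hST hS
    rcases Finset.mem_filter.1 (Finset.mem_coe.1 hS) with ⟨_, B, hB, hSB⟩
    exact Finset.mem_coe.2 (Finset.mem_filter.2 ⟨Finset.mem_univ _, B, hB,
      (Finset.compl_subset_compl.2 hST).trans hSB⟩)
  have hU : IsUpperSet (U : Set (Finset α)) := by
    intro S T hST hS
    rcases Finset.mem_filter.1 (Finset.mem_coe.1 hS) with ⟨_, A, hA, hAS⟩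
    exact Finset.mem_coe.2 (Finset.mem_filter.2 ⟨Finset.mem_univ _, A, hA, hAS.trans hST⟩)
  have hV : IsUpperSet (V : Set (Finset α)) := by
    intro S T hST hS
    rcases Finset.mem_filter.1 (Finset.mem_coe.1 hS) with ⟨_, B, hB, hBS⟩
    exact Finset.mem_coe.2 (Finset.mem_filter.2 ⟨Finset.mem_univ _, B, hB, hBS.trans hST⟩)
  have hQP : Q ⊆ P := by
    intro S hS
    rcases Finset.mem_filter.1 hS with ⟨_, B, hB, hSB⟩
    exact Finset.mem_filter.2 ⟨Finset.mem_univ _, B, Finset.mem_union_right _ hB, hSB⟩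
  have main := card_elements_le_card_targets P Q U V hP hQ hU hV hQP
  -- `𝒜` injects into `E₁` and `ℬ` into `E₂` via complements
  have hA : #𝒜 ≤ #(P.filter (fun S => Sᶜ ∈ U ∧ Sᶜ ∉ V)) := by
    refine Finset.card_le_card_of_injOn (fun A => Aᶜ) ?_ ?_
    · intro A hA
      have hA' : A ∈ 𝒜 := Finset.mem_coe.1 hA
      refine Finset.mem_coe.2 (Finset.mem_filter.2 ⟨?_, ?_, ?_⟩)
      · exact Finset.mem_filter.2 ⟨Finset.mem_univ _, A, Finset.mem_union_left _ hA', by simp⟩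
      · exact Finset.mem_filter.2 ⟨Finset.mem_univ _, A, hA', by simp⟩
      · intro hAV
        rcases Finset.mem_filter.1 hAV with ⟨_, B, hB, hBA⟩
        exact h A hA' B hB (by simpa using hBA)
    · intro A _ A' _ hAA'
      exact compl_injective hAA'
  have hB : #ℬ ≤ #(Q.filter (fun S => Sᶜ ∈ V)) := by
    refine Finset.card_le_card_of_injOn (fun B => Bᶜ) ?_ ?_
    · intro B hB
      have hB' : B ∈ ℬ := Finset.mem_coe.1 hB
      refine Finset.mem_coe.2 (Finset.mem_filter.2 ⟨?_, ?_⟩)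
      · exact Finset.mem_filter.2 ⟨Finset.mem_univ _, B, hB', by simp⟩
      · exact Finset.mem_filter.2 ⟨Finset.mem_univ _, B, hB', by simp⟩
    · intro B _ B' _ hBB'
      exact compl_injective hBB'
  -- the targets inject into the down-closure of the difference family via complements
  have hZ : #((P ∩ U) ∪ (Q ∩ V))
      ≤ #(((𝒜 \\ 𝒜) ∪ (ℬ \\ 𝒜) ∪ (ℬ \\ ℬ)).biUnion Finset.powerset) := by
    refine Finset.card_le_card_of_injOn (fun T => Tᶜ) ?_ ?_
    · intro T hT
      have hT' : T ∈ (P ∩ U) ∪ (Q ∩ V) := Finset.mem_coe.1 hT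
      refine Finset.mem_coe.2 (Finset.mem_biUnion.2 ?_)
      rcases Finset.mem_union.1 hT' with hPU | hQV
      · rcases Finset.mem_inter.1 hPU with ⟨hTP, hTU⟩
        rcases Finset.mem_filter.1 hTP with ⟨_, C, hC, hTC⟩
        rcases Finset.mem_filter.1 hTU with ⟨_, A, hA, hAT⟩
        refine ⟨C \ A, ?_, ?_⟩
        · rcases Finset.mem_union.1 hC with hC𝒜 | hCℬ
          · exact Finset.mem_union_left _ (Finset.mem_union_left _
              (Finset.mem_diffs.2 ⟨C, hC𝒜, A, hA, rfl⟩))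
          · exact Finset.mem_union_left _ (Finset.mem_union_right _
              (Finset.mem_diffs.2 ⟨C, hCℬ, A, hA, rfl⟩))
        · refine Finset.mem_powerset.2 ?_
          intro x hx
          refine Finset.mem_sdiff.2 ⟨hTC hx, ?_⟩
          intro hxA
          exact (Finset.mem_compl.1 hx) (hAT hxA)
      · rcases Finset.mem_inter.1 hQV with ⟨hTQ, hTV⟩
        rcases Finset.mem_filter.1 hTQ with ⟨_, B, hB, hTB⟩
        rcases Finset.mem_filter.1 hTV with ⟨_, B', hB', hB'T⟩
        refine ⟨B \ B', ?_, ?_⟩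
        · exact Finset.mem_union_right _ (Finset.mem_diffs.2 ⟨B, hB, B', hB', rfl⟩)
        · refine Finset.mem_powerset.2 ?_
          intro x hx
          refine Finset.mem_sdiff.2 ⟨hTB hx, ?_⟩
          intro hxB'
          exact (Finset.mem_compl.1 hx) (hB'T hxB')
    · intro T _ T' _ hTT'
      exact compl_injective hTT'
  omega

end StaircaseKleitman

end Summit.CriticalPhenomena.PercolationContinuityZ3.Theorems
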